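import Summits.AtomisticToContinuum.FouriersLaw.Theses.BondHeatUncertainty
import Summits.AtomisticToContinuum.FouriersLaw.Theorems.BondHeatUncertaintyDefs
import Summits.AtomisticToContinuum.FouriersLaw.Theorems.BondHeatUncertaintySubdiffusiveBondHeatBathBondReductionVariance
import Summits.AtomisticToContinuum.FouriersLaw.Theorems.BondHeatUncertaintySubdiffusiveBondHeatBathBondReductionDynkin
import Literature.MathematicalPhysics.KineticTheory.LangevinChainKernel
import Literature.MathematicalPhysics.KineticTheory.LangevinChainGibbs
import Literature.MathematicalPhysics.KineticTheory.LangevinChainNESSProofs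
import Literature.MathematicalPhysics.KineticTheory.LangevinChainEnergyIdentity
import Summits.AtomisticToContinuum.FouriersLaw.Theorems.BondHeatUncertaintyLinearResponseFTURNessFacts

/-!
# `LinearResponseFTUR` / line `lebesgue-flip-duality`, stub K6a: the equilibrium bond-heat variance

Helper file for crux (★) `stmt-AtomisticToContinuum-9122` (`BondHeatUncertainty.LinearResponseFTUR`), line
`lebesgue-flip-duality`, stub `stub_equilibriumBondHeatVariance`. The crux's variance `V_N(b,t)` is the
KERNEL-LEVEL quantity `bondHeatVariance … = 2∫₀ᵗ (t-s) C_N(b,s) ds`, `C_N(b,s) = ∫ j_b · (P_s j_b) dμ_T`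
(`eqCurrentAutocorr`); the entropy-balance route reads it as the variance of the bond-heat coordinate
`Q^{(b)} = ∫₀ᵗ j_b(z_s) ds` of the flux law `fluxLaw … (μ N T T)` of the stationary process. Under weak-NESS
uniqueness (U) the family member `μ N T T` IS the Gibbs measure `μ_T`, which is therefore invariant under the
constructed kernels (`ness_eq_gibbsMeasure`, `gibbsMeasure_bind_transitionKernel` of the lead's
`…LinearResponseFTURNessFacts`); then

* `E Q = t · μ_T(j_b) = 0` (one-time law of the flow + `pinnedChain_integral_bondCurrent_gibbsMeasure`),
* `E Q² = 2∫₀ᵗ (t-r) ⟨j_b, P_r j_b⟩_{μ_T} dr = V_N(b,t)` (the sibling crux's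
  `pinnedChain_integral_sq_intervalIntegral_of_invariant`, part 4b of the bath–bond reduction),
* `Q ∈ L²` (`pinnedChain_integrable_intervalIntegral_mul_of_invariant`),

and the statement about the image law `fluxLaw` follows by `memLp_map_measure_iff` / `variance_map` once the
raw observable map `(z, w) ↦ (z, z_t, I_{i0}, I_{iN}, Q^{(b)})` is known to be measurable
(`EquilibriumBondHeatVariance.measurable_rawObs_fwdPath`; the two flow helpers live in the sub-namespace
`…LinearResponseFTUR.EquilibriumBondHeatVariance` to keep the line's shared namespace free of name clashes).

Nothing here closes an item.
-/

noncomputable section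

namespace Summit.AtomisticToContinuum.FouriersLaw.Theorems.LinearResponseFTUR

open MeasureTheory ProbabilityTheory Filter Topology Set
open scoped NNReal ENNReal
open Literature.MathematicalPhysics.KineticTheory
open Literature.MathematicalPhysics.KineticTheory.HeatConduction
open Literature.Probability.Process
open Summit.AtomisticToContinuum.FouriersLaw.Theorems.BondHeatUncertainty
open Summit.AtomisticToContinuum.FouriersLaw.Theorems.SubdiffusiveBondHeat

/-! ### Measurability of the raw observable and the mean of a time integral along the stationary flow -/

namespace EquilibriumBondHeatVariance

section Flow

variable {ω₂ lam β γ : ℝ} (hω : 0 < ω₂) (hl : 0 ≤ lam) (hβ : 0 ≤ β) (hγ : 0 ≤ γ) (N : ℕ) (T_L T_R : ℝ)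
include hω hl hβ hγ

/-- **The raw observable of the forward process is measurable**: `(z, w) ↦ (z, z_t, I_{i0}, I_{iN}, Q^{(ib)})`,
`z_s = Φ_s(z, B(w))`, is a measurable map `PhaseSpace N × WienerPair → Obs N` (the endpoints by
`pinnedChain_measurable_solMap_pairPath`; the three time integrals are parametric interval integrals of
integrands continuous in time and measurable in `(z, w)`). [folklore] -/
theorem measurable_rawObs_fwdPath (i0 iN ib : Fin N) (t : ℝ) :
    Measurable fun zw : PhaseSpace N × WienerPair =>
      rawObs (pinnedChain ω₂ lam β γ) N i0 iN ib t zw.1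
        (fwdPath (pinnedChain ω₂ lam β γ) N T_L T_R zw.1 zw.2) := by
  have hsol := fun s : ℝ => pinnedChain_measurable_solMap_pairPath hω hl hβ hγ N T_L T_R s
  have hcont := fun zw : PhaseSpace N × WienerPair =>
    pinnedChain_continuous_solMap hω hl hβ hγ N T_L T_R zw.1 (pairPath zw.2)
  have hH : ContDiff ℝ 1 ((pinnedChain ω₂ lam β γ).hamiltonian N) :=
    pinnedChain_contDiff_hamiltonian ω₂ lam β γ N
  have hdq : ∀ i : Fin N, Continuous (partialQ i ((pinnedChain ω₂ lam β γ).hamiltonian N)) := fun i =>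
    (pinnedChain ω₂ lam β γ).continuous_partialQ_hamiltonian hH i
  have hj : Continuous ((pinnedChain ω₂ lam β γ).bondCurrent N ib) :=
    pinnedChain_continuous_bondCurrent ω₂ lam β γ N ib
  have hwork : ∀ i : Fin N, Measurable fun zw : PhaseSpace N × WienerPair =>
      ∫ s in (0 : ℝ)..t, ((pinnedChain ω₂ lam β γ).solMap N T_L T_R s zw.1 (pairPath zw.2)).2 i *
        partialQ i ((pinnedChain ω₂ lam β γ).hamiltonian N)
          ((pinnedChain ω₂ lam β γ).solMap N T_L T_R s zw.1 (pairPath zw.2)) := by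
    intro i
    refine measurable_intervalIntegral_of_continuous_of_measurable
      (u := fun (s : ℝ) (zw : PhaseSpace N × WienerPair) =>
        ((pinnedChain ω₂ lam β γ).solMap N T_L T_R s zw.1 (pairPath zw.2)).2 i *
          partialQ i ((pinnedChain ω₂ lam β γ).hamiltonian N)
            ((pinnedChain ω₂ lam β γ).solMap N T_L T_R s zw.1 (pairPath zw.2)))
      (fun zw => ?_) (fun s => ?_) t
    · have h := (((continuous_apply i).comp (continuous_snd.comp (hcont zw))).mul
        ((hdq i).comp (hcont zw)))
      exact h
    · have h := (((measurable_pi_apply i).comp (measurable_snd.comp (hsol s))).mul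
        ((hdq i).measurable.comp (hsol s)))
      exact h
  have hheat : Measurable fun zw : PhaseSpace N × WienerPair =>
      ∫ s in (0 : ℝ)..t, (pinnedChain ω₂ lam β γ).bondCurrent N ib
        ((pinnedChain ω₂ lam β γ).solMap N T_L T_R s zw.1 (pairPath zw.2)) := by
    refine measurable_intervalIntegral_of_continuous_of_measurable
      (u := fun (s : ℝ) (zw : PhaseSpace N × WienerPair) => (pinnedChain ω₂ lam β γ).bondCurrent N ib
        ((pinnedChain ω₂ lam β γ).solMap N T_L T_R s zw.1 (pairPath zw.2)))
      (fun zw => ?_) (fun s => ?_) t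
    · have h := hj.comp (hcont zw)
      exact h
    · have h := hj.measurable.comp (hsol s)
      exact h
  have h := measurable_fst.prodMk ((hsol t).prodMk ((hwork i0).prodMk ((hwork iN).prodMk hheat)))
  simp only [rawObs_apply, fwdPath_apply]
  exact h

/-- **Mean of a time integral along the stationary flow**: for the pinned chain started from a finite
initial law `μ` invariant for the constructed kernels, `f` measurable with `f² ∈ L¹(μ)` and `t ≥ 0`,
`E_{μ⊗W}[∫₀ᵗ f(z_s) ds] = t · ∫ f dμ` (Fubini — the integrand is in `L²` of the finite measure
`μ ⊗ W ⊗ Leb↾(0,t]` by the one-time law — and `law(z_s) = μ`). [folklore] -/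
theorem pinnedChain_integral_intervalIntegral_of_invariant (μ : Measure (PhaseSpace N)) [IsFiniteMeasure μ]
    (hinv : ∀ s : ℝ≥0, μ.bind ((pinnedChain ω₂ lam β γ).transitionKernel N T_L T_R s) = μ)
    {f : PhaseSpace N → ℝ} (hf : Measurable f) (hf2 : Integrable (fun y => f y ^ 2) μ) {t : ℝ}
    (ht : 0 ≤ t) :
    ∫ p, (∫ s in (0 : ℝ)..t, f ((pinnedChain ω₂ lam β γ).solMap N T_L T_R s p.1 (pairPath p.2)))
        ∂(μ.prod wienerPair) = t * ∫ y, f y ∂μ := by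
  haveI hLfin : IsFiniteMeasure ((volume : Measure ℝ).restrict (Ioc 0 t)) := by
    refine ⟨?_⟩
    rw [Measure.restrict_apply_univ]
    exact measure_Ioc_lt_top
  have hZ := pinnedChain_measurable_solMap_process hω hl hβ hγ N T_L T_R
  -- the integrand on `Ω × (0, t]`
  have hGm : Measurable (Function.uncurry fun (p : PhaseSpace N × WienerPair) (s : ℝ) =>
      f ((pinnedChain ω₂ lam β γ).solMap N T_L T_R s p.1 (pairPath p.2))) := by
    have h1 : Measurable fun w : (PhaseSpace N × WienerPair) × ℝ => (w.2, w.1) :=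
      measurable_snd.prodMk measurable_fst
    have h := hf.comp (hZ.comp h1)
    exact h
  have hCf : ∫⁻ y, ‖f y‖ₑ ^ 2 ∂μ < ∞ := by
    have h1 := hf2.hasFiniteIntegral
    unfold HasFiniteIntegral at h1
    simpa [enorm_pow] using h1
  have hG2 : Integrable (fun w : (PhaseSpace N × WienerPair) × ℝ =>
      (f ((pinnedChain ω₂ lam β γ).solMap N T_L T_R w.2 w.1.1 (pairPath w.1.2))) ^ 2)
      ((μ.prod wienerPair).prod ((volume : Measure ℝ).restrict (Ioc 0 t))) := by
    refine ⟨(hGm.pow_const 2).aestronglyMeasurable, ?_⟩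
    unfold HasFiniteIntegral
    have hm2 : Measurable fun w : (PhaseSpace N × WienerPair) × ℝ =>
        ‖f ((pinnedChain ω₂ lam β γ).solMap N T_L T_R w.2 w.1.1 (pairPath w.1.2))‖ₑ ^ 2 :=
      hGm.enorm.pow_const 2
    calc ∫⁻ w, ‖(f ((pinnedChain ω₂ lam β γ).solMap N T_L T_R w.2 w.1.1 (pairPath w.1.2))) ^ 2‖ₑ
          ∂((μ.prod wienerPair).prod ((volume : Measure ℝ).restrict (Ioc 0 t)))
        = ∫⁻ w, ‖f ((pinnedChain ω₂ lam β γ).solMap N T_L T_R w.2 w.1.1 (pairPath w.1.2))‖ₑ ^ 2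
            ∂((μ.prod wienerPair).prod ((volume : Measure ℝ).restrict (Ioc 0 t))) := by
          simp only [enorm_pow]
      _ = ∫⁻ s, ∫⁻ p, ‖f ((pinnedChain ω₂ lam β γ).solMap N T_L T_R s p.1 (pairPath p.2))‖ₑ ^ 2
            ∂(μ.prod wienerPair) ∂((volume : Measure ℝ).restrict (Ioc 0 t)) :=
          lintegral_prod_symm _ hm2.aemeasurable
      _ = ∫⁻ _s, ∫⁻ y, ‖f y‖ₑ ^ 2 ∂μ ∂((volume : Measure ℝ).restrict (Ioc 0 t)) := by
          refine lintegral_congr fun s => ?_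
          exact pinnedChain_lintegral_sq_solMap_of_invariant hω hl hβ hγ N T_L T_R μ hinv hf s
      _ = (∫⁻ y, ‖f y‖ₑ ^ 2 ∂μ) * ((volume : Measure ℝ).restrict (Ioc 0 t)) univ := lintegral_const _
      _ < ∞ := ENNReal.mul_lt_top hCf (measure_lt_top _ _)
  have hGi : Integrable (Function.uncurry fun (p : PhaseSpace N × WienerPair) (s : ℝ) =>
      f ((pinnedChain ω₂ lam β γ).solMap N T_L T_R s p.1 (pairPath p.2)))
      ((μ.prod wienerPair).prod ((volume : Measure ℝ).restrict (Ioc 0 t))) :=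
    ((memLp_two_iff_integrable_sq hGm.aestronglyMeasurable).2 hG2).integrable one_le_two
  -- the one-time law at each `s ∈ (0, t]`
  have hinner : ∀ s ∈ Ioc (0 : ℝ) t,
      ∫ p, f ((pinnedChain ω₂ lam β γ).solMap N T_L T_R s p.1 (pairPath p.2)) ∂(μ.prod wienerPair) =
        ∫ y, f y ∂μ := by
    intro s hs
    have e1 : ((s.toNNReal : ℝ≥0) : ℝ) = s := Real.coe_toNNReal s hs.1.le
    have hlaw := pinnedChain_map_solMap_of_invariant hω hl hβ hγ N T_L T_R μ s.toNNReal (hinv _)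
    rw [e1] at hlaw
    have hm := pinnedChain_measurable_solMap_pairPath hω hl hβ hγ N T_L T_R s
    calc ∫ p, f ((pinnedChain ω₂ lam β γ).solMap N T_L T_R s p.1 (pairPath p.2)) ∂(μ.prod wienerPair)
        = ∫ y, f y ∂((μ.prod wienerPair).map
            (fun p => (pinnedChain ω₂ lam β γ).solMap N T_L T_R s p.1 (pairPath p.2))) :=
          (integral_map hm.aemeasurable hf.aestronglyMeasurable).symm
      _ = ∫ y, f y ∂μ := by rw [hlaw]
  have hpt : ∀ p : PhaseSpace N × WienerPair,
      (∫ s in (0 : ℝ)..t, f ((pinnedChain ω₂ lam β γ).solMap N T_L T_R s p.1 (pairPath p.2))) =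
        ∫ s in Ioc 0 t, f ((pinnedChain ω₂ lam β γ).solMap N T_L T_R s p.1 (pairPath p.2)) :=
    fun p => intervalIntegral.integral_of_le ht
  rw [integral_congr_ae (Eventually.of_forall hpt), integral_integral_swap hGi]
  rw [setIntegral_congr_fun measurableSet_Ioc hinner, setIntegral_const, Real.volume_real_Ioc_of_le ht,
    sub_zero, smul_eq_mul]

end Flow

end EquilibriumBondHeatVariance

/-! ### The stub -/

/-- **K6a — the equilibrium bond-heat variance is `V_N(b,t)`.** For the pinned chain (all parameters
positive), under weak-NESS uniqueness (U), along any steady-state family `μ`, at equal temperatures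
`T_L = T_R = T > 0`, for `N ≥ 2`, a real bond `ib` (`ib + 1 < N`) and `t > 0`: the bond-heat coordinate
`Q^{(b)}` of the flux law `fluxLaw P N i0 iN ib T T t (μ N T T)` is square integrable and its variance is
`bondHeatVariance ω₂ lam β γ T N ib t = 2∫₀ᵗ (t-s) C_N(b,s) ds`.
Proof: `μ N T T = μ_T` (Gibbs, by (U): `ness_eq_gibbsMeasure`), invariant under the constructed kernels
(`gibbsMeasure_bind_transitionKernel`); transport to `μ_T ⊗ W` along the measurable raw-observable map
(`memLp_map_measure_iff`, `variance_map`), where `Q = ∫₀ᵗ j_b(z_s) ds` has mean `t·μ_T(j_b) = 0`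
(`pinnedChain_integral_intervalIntegral_of_invariant`, `pinnedChain_integral_bondCurrent_gibbsMeasure`), is in
`L²` and has second moment `2∫₀ᵗ (t-r)⟨j_b, P_r j_b⟩_{μ_T} dr` (sibling crux 9120:
`pinnedChain_integral_sq_intervalIntegral_of_invariant`), which is `bondHeatVariance` verbatim. [folklore] -/
theorem stub_equilibriumBondHeatVariance :
  ∀ ω₂ lam β γ : ℝ, 0 < ω₂ → 0 < lam → 0 < β → 0 < γ →
  (∀ (N : ℕ) (T_L T_R : ℝ), 0 < T_L → 0 < T_R → ∀ μ ν : Measure (PhaseSpace N),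
    (pinnedChain ω₂ lam β γ).IsSteadyState N T_L T_R μ →
    (pinnedChain ω₂ lam β γ).IsSteadyState N T_L T_R ν → μ = ν) →
  ∀ μ : (N : ℕ) → ℝ → ℝ → Measure (PhaseSpace N),
    (∀ (N : ℕ) (T_L T_R : ℝ), 0 < T_L → 0 < T_R →
      (pinnedChain ω₂ lam β γ).IsSteadyState N T_L T_R (μ N T_L T_R)) →
  ∀ T : ℝ, 0 < T → ∀ (N : ℕ) (i0 iN ib : Fin N), 2 ≤ N → i0.val = 0 → iN.val = N - 1 →
    ib.val + 1 < N → ∀ t : ℝ, 0 < t →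
    MemLp (fun p : Obs N => p.2.2.2.2) 2 (fluxLaw (pinnedChain ω₂ lam β γ) N i0 iN ib T T t (μ N T T)) ∧
    variance (fun p : Obs N => p.2.2.2.2) (fluxLaw (pinnedChain ω₂ lam β γ) N i0 iN ib T T t (μ N T T)) =
      bondHeatVariance ω₂ lam β γ T N ib.val t := by
  intro ω₂ lam β γ hω hl hβ hγ huniq μ hμ T hT N i0 iN ib hN _hi0 _hiN _hib t ht
  have hGibbs : μ N T T = (pinnedChain ω₂ lam β γ).gibbsMeasure N T :=
    ness_eq_gibbsMeasure hω hl hβ huniq μ hμ N hT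
  have hinv : ∀ u : ℝ≥0, ((pinnedChain ω₂ lam β γ).gibbsMeasure N T).bind
      ((pinnedChain ω₂ lam β γ).transitionKernel N T T u) = (pinnedChain ω₂ lam β γ).gibbsMeasure N T :=
    fun u => gibbsMeasure_bind_transitionKernel hω hl hβ hγ huniq hN hT u
  haveI hprob : IsProbabilityMeasure ((pinnedChain ω₂ lam β γ).gibbsMeasure N T) :=
    pinnedChain_isProbabilityMeasure_gibbsMeasure hω hl.le hβ.le γ N hT
  rw [hGibbs]
  -- the raw observable map and the bond-heat coordinate
  have hΦ : Measurable fun zw : PhaseSpace N × WienerPair =>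
      rawObs (pinnedChain ω₂ lam β γ) N i0 iN ib t zw.1 (fwdPath (pinnedChain ω₂ lam β γ) N T T zw.1 zw.2) :=
    EquilibriumBondHeatVariance.measurable_rawObs_fwdPath hω hl.le hβ.le hγ.le N T T i0 iN ib t
  have hcoord : Measurable fun p : Obs N => p.2.2.2.2 :=
    measurable_snd.snd.snd.snd
  have hcomp : (fun p : Obs N => p.2.2.2.2) ∘ (fun zw : PhaseSpace N × WienerPair =>
      rawObs (pinnedChain ω₂ lam β γ) N i0 iN ib t zw.1 (fwdPath (pinnedChain ω₂ lam β γ) N T T zw.1 zw.2)) =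
      fun zw : PhaseSpace N × WienerPair => ∫ s in (0 : ℝ)..t, (pinnedChain ω₂ lam β γ).bondCurrent N ib
        ((pinnedChain ω₂ lam β γ).solMap N T T s zw.1 (pairPath zw.2)) := rfl
  -- the current: measurable, square integrable, mean zero
  have hjm : Measurable ((pinnedChain ω₂ lam β γ).bondCurrent N ib) :=
    (pinnedChain_continuous_bondCurrent ω₂ lam β γ N ib).measurable
  have hj2 : Integrable (fun y => (pinnedChain ω₂ lam β γ).bondCurrent N ib y ^ 2)
      ((pinnedChain ω₂ lam β γ).gibbsMeasure N T) :=
    pinnedChain_integrable_sq_bondCurrent hω hl.le hβ.le γ N hT ib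
  -- the bond heat `Q` on `Ω = PhaseSpace N × WienerPair`
  have hQm : Measurable fun zw : PhaseSpace N × WienerPair => ∫ s in (0 : ℝ)..t,
      (pinnedChain ω₂ lam β γ).bondCurrent N ib ((pinnedChain ω₂ lam β γ).solMap N T T s zw.1 (pairPath zw.2)) := by
    rw [← hcomp]
    exact hcoord.comp hΦ
  have hQ2 : Integrable (fun zw : PhaseSpace N × WienerPair => (∫ s in (0 : ℝ)..t,
      (pinnedChain ω₂ lam β γ).bondCurrent N ib ((pinnedChain ω₂ lam β γ).solMap N T T s zw.1 (pairPath zw.2))) ^ 2)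
      (((pinnedChain ω₂ lam β γ).gibbsMeasure N T).prod wienerPair) := by
    have h := pinnedChain_integrable_intervalIntegral_mul_of_invariant hω hl.le hβ.le hγ.le N T T
      ((pinnedChain ω₂ lam β γ).gibbsMeasure N T) hinv hjm hjm hj2 hj2 ht.le
    refine h.congr (Eventually.of_forall fun zw => ?_)
    simp only [sq]
  have hmean : ∫ zw, (∫ s in (0 : ℝ)..t, (pinnedChain ω₂ lam β γ).bondCurrent N ib
      ((pinnedChain ω₂ lam β γ).solMap N T T s zw.1 (pairPath zw.2)))
      ∂(((pinnedChain ω₂ lam β γ).gibbsMeasure N T).prod wienerPair) = 0 := by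
    rw [EquilibriumBondHeatVariance.pinnedChain_integral_intervalIntegral_of_invariant hω hl.le hβ.le hγ.le
      N T T ((pinnedChain ω₂ lam β γ).gibbsMeasure N T) hinv hjm hj2 ht.le,
      pinnedChain_integral_bondCurrent_gibbsMeasure, mul_zero]
  have hsq := pinnedChain_integral_sq_intervalIntegral_of_invariant hω hl.le hβ.le hγ.le N T T
    ((pinnedChain ω₂ lam β γ).gibbsMeasure N T) hinv hjm hj2 ht.le
  refine ⟨?_, ?_⟩
  · rw [fluxLaw_eq, memLp_map_measure_iff hcoord.aestronglyMeasurable hΦ.aemeasurable, hcomp]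
    exact (memLp_two_iff_integrable_sq hQm.aestronglyMeasurable).2 hQ2
  · rw [fluxLaw_eq, variance_map hcoord.aemeasurable hΦ.aemeasurable, hcomp,
      variance_of_integral_eq_zero hQm.aemeasurable hmean, hsq, bondHeatVariance_eq]
    simp only [eqCurrentAutocorr, dif_pos ib.isLt, Fin.eta]

end Summit.AtomisticToContinuum.FouriersLaw.Theorems.LinearResponseFTUR

end
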